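/-
COR-CM (cell pub-hodgecm2, stage 2 of the Hodge ladder) — TRANSPOSITION SURGE, DICTIONARY ITEM (vi) of rfwf v3 §4.2 (tex
ll. 261–265), DISCHARGE FILE 2 of the item-(vi) prover `pub-hodgecm2-tr-prover-6` (rule (1) pre-ACK pattern
`Transposition/Item6Holds*.lean`, HOME/INBOX l.3657; sequel of `Transposition/Item6Holds.lean`, p277882): the leaf B01-H binder `hW`
of that file DISCHARGED BY NAME by item6-p4's `Transposition.Model.heckeWedge10_of_heckeFamily` (`Transposition/Item6HeckeFamily.lean`,
p277416: B01-H with remembered translates PROVED on the model over `UnitaryBallHeckeWedge` + `B01/HeckePair`; a second kernel road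
to p260689's `Model.heckeWedge10_holds`, which is still in review).  Theorems only; no `def`, no cite binder, nothing cited as a
record, nothing asserted, no `sorry`.  After this file the ONLY displayed binder of item (vi) is SUPPLY (ITEM6-SPLIT S2) — in the
three kernel normal forms below — and, for the day-1 assembly, the `L²` dictionary of item (iii) with item (v)'s isolation.
FRAMING (COORDINATOR RULING 2026-08-21T11:55:35Z): HC_CM is NOT proved; nobody has inhabited the supply statement.
ERRATUM carried (lead, HOME/INBOX l.3831 (2)): `Item6SupplyAssembly.lean`:95–96 — `supply` is NOT attributed to [GR91 Prop 3.1.1].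
-/
import Summits.HodgeConjecture.CorCM.B01.Transposition.Item6Holds
import Summits.HodgeConjecture.CorCM.B01.Transposition.Item6HeckeFamily
import HarnessLib

/-!
# Transposition item (vi) ⇔ SUPPLY on the model universe, the leaf B01-H discharged

On `U = Model.picardCMUniverse hHD hI h₁ h₃` the leaf B01-H `U.HeckeWedge10` (`B01/FaceInputsSplit.lean:177`) is the THEOREM
`Transposition.Model.heckeWedge10_of_heckeFamily hHD hI h₁ h₃` (Venkataramana 2001 Thm 8 / Clozel 1993, holomorphic case, proved
on the model).  Substituting it into `Transposition/Item6Holds.lean` (§4–§5 there):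

* `faceThetaSupplyWedgeExists_iff_exists_supply'` / `_iff_exists_hom_ne_zero'` / `_iff_exists_slotReach'` — item (vi)'s typed
  axiom `Transposition.FaceThetaSupplyWedgeExists U` (`Item6SupplyAssembly.lean:275`) is EQUIVALENT, with NO other binder, to
  supply in the ∃ι₁ ∃V ∃Γ form, to the Albanese reach of the two slot varieties, and to their slot reach (levels independent);
* `faceThetaSupplyWedgeExists_of_faceSupply'` — B01-S (`U.FaceSupply`, ∀ι₁ ∀V) implies it; `_rec` instance on the universe of record;
* `faceThetaDataExists_of_saturated_items'` — `U.FaceThetaDataExists` (`Transposition/Assembly.lean:52`) from the joint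
  ∃-statement ALONE (supply · `L²` dictionary · isolation for the saturated sets, one `(ι₁, V)` per face), and
  `faceThetaDataExists_of_supply_of_dictionary` — the same with the joint statement SPLIT into the ∃ι₁ ∃V supply (V-sensitive, S2)
  and a ∀ι₁ ∀V dictionary-with-isolation clause (items (iii)+(v), V-uniform), which is how the two lineages deliver them;
* `hc_cm_of_supply_of_dictionary_of_eq` — on THE universe of record (`hU : U = U_rec`, by `rfl`), `HC_CM` from those two
  statements and nothing else
  (`Model.hc_cm_closed_of_faceThetaDataExists`, `Transposition/Assembly.lean:85`).  HC_CM is NOT proved: neither is inhabited.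

* `Transposition.faceThetaDataExists_of_wedgeMeet` / `Model.hc_cm_of_wedgeMeet_of_eq` — the PINNED form: per face, the `L²`
  dictionary and ONE non-zero (12)-wedge of isotypic classes whose `L²`-image lies in the closed (34)-span suffice (pinned theta sets
  `{ω₀}, {ω₁}` at one level, `U_{ψ₂}, U_{ψ₃}`); no B01-H, no separate supply, no coupling for all classes;
  `Transposition.faceThetaDataExists_iff_wedgeMeet` — this pinned statement is a NORMAL FORM of `U.FaceThetaDataExists` (↔).

PRICE OF THE SATURATED CHOICE (honest accounting, so that the two (vi)-routes are compared like for like; item6-p3, HOME/INBOX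
2026-08-21T14:08:22Z): with `Theta := Uiso` the item-(vi) side costs only SUPPLY, but the clause `hD` asks item (v)'s `IsolationSpans`
for ALL isotypic classes `U_{ψ i}(Γ)_{ι₁}` — its `Gen12` conjunct (`Transposition.IsolationSpans.Gen12`, `Item5IsolationSpans.lean:194`, at
`Θ := Uiso`) is PerL Lemma 3.4 / Thm 3.7 (`S₁₂ = S₃₄`) PLUS THETA EXHAUSTION of `U_ψ` («every ψ-isotypic σ-eigen holomorphic one-form is a
limit of combinations of theta one-forms»: [Liu 2021] Prop. 4.13, TeX ll. 2113–2119, Rem. 4.14 from [GR91]/Rogawski 1992 at `n = 3`,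
with Thm 4.18 (2); the old B01-O caveat, `B01/ThetaRealisationSocket.lean:35–38`) — an input that is in NO as-printed binder; whereas for
a theta model `S` with `S.Theta ⊊ Uiso` (own-htheta lineage) item (v) is Thm 3.7 verbatim and the extra inputs sit on the (vi) side
(`Theta_sub` = [Liu 2021 Thm 4.18]-type placement, theta NON-VANISHING — then [GR91 3.1.1]/Rallis is NOT idle —, `TranslateClosed` for
`Transposition.Model.heckeFamily`, item6-p4).  Either way ONE of {exhaustion, theta-side S1–S3} is a visible binder; neither is degree-
or face-specific; neither route is closed.  The PINNED normal form below is where the two routes MEET: one coupled non-zero (12)-wedge.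
-/

noncomputable section

open scoped TensorProduct InnerProductSpace

namespace Summit.HodgeConjecture.CorCM

namespace Model

open CategoryTheory
open Literature.AlgebraicGeometry.Motives (CMType HodgeStructure)
open Literature.AlgebraicGeometry.Motives.HodgeStructure (conj)
open Literature.NumberTheory.Automorphic
open Literature.NumberTheory.Automorphic.PicardCM
open Literature.AlgebraicGeometry.HodgeTheory
open Literature.AlgebraicGeometry.Motives (Jacobian)

/-- **B01-S ⇒ item (vi)** on a model universe, nothing else displayed (B01-H = `Transposition.Model.heckeWedge10_of_heckeFamily`). [folklore] -/
theorem faceThetaSupplyWedgeExists_of_faceSupply' (hHD : exists_isReal_hodgeModel) (hI : hodgePQ_independent_of_hodgeModel)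
    (h₁ : BallQuotientUniformised) (h₃ : CMAbelianVarietyRealised) (hS : (picardCMUniverse hHD hI h₁ h₃).FaceSupply) :
    Transposition.FaceThetaSupplyWedgeExists (picardCMUniverse hHD hI h₁ h₃) :=
  faceThetaSupplyWedgeExists_of_faceSupply hHD hI h₁ h₃ (Transposition.Model.heckeWedge10_of_heckeFamily hHD hI h₁ h₃) hS

/-- **Item (vi) ⇔ supply (∃ι₁ ∃V ∃Γ)** on a model universe, nothing else displayed. [folklore] -/
theorem faceThetaSupplyWedgeExists_iff_exists_supply' (hHD : exists_isReal_hodgeModel)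
    (hI : hodgePQ_independent_of_hodgeModel) (h₁ : BallQuotientUniformised) (h₃ : CMAbelianVarietyRealised) :
    Transposition.FaceThetaSupplyWedgeExists (picardCMUniverse hHD hI h₁ h₃) ↔
      ∀ (F : CMField), IsGalois ℚ F → 6 ≤ Module.finrank ℚ F → ∀ f : Face F,
        ∃ ι₁ : F →+* ℂ, f.Admissible ι₁ ∧ ∃ (V : HermSpace3 F ι₁) (Γ : Level V)
          (ω₀ ω₁ : (picardCMUniverse hHD hI h₁ h₃).CohC ((picardCMUniverse hHD hI h₁ h₃).pms F ι₁ V Γ) 1),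
          ω₀ ∈ (picardCMUniverse hHD hI h₁ h₃).Uiso Γ F (f.psi 0) ι₁ ∧
            ω₁ ∈ (picardCMUniverse hHD hI h₁ h₃).Uiso Γ F (f.psi 1) ι₁ ∧ ω₀ ≠ 0 ∧ ω₁ ≠ 0 :=
  faceThetaSupplyWedgeExists_iff_exists_supply hHD hI h₁ h₃ (Transposition.Model.heckeWedge10_of_heckeFamily hHD hI h₁ h₃)

/-- **Item (vi) ⇔ Albanese reach of the two slot varieties** on a model universe, nothing else displayed: per Galois CM field `F`
of degree `≥ 6` and face `f`, at SOME admissible `ι₁`, SOME `V`, SOME level and some (any) Albanese datum of `P_Γ`, non-zero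
homomorphisms `Alb(P_Γ) → A_{(F,ψ₀)}` and `Alb(P_Γ) → A_{(F,ψ₁)}`. [folklore] -/
theorem faceThetaSupplyWedgeExists_iff_exists_hom_ne_zero' (hHD : exists_isReal_hodgeModel)
    (hI : hodgePQ_independent_of_hodgeModel) (h₁ : BallQuotientUniformised) (h₃ : CMAbelianVarietyRealised) :
    Transposition.FaceThetaSupplyWedgeExists (picardCMUniverse hHD hI h₁ h₃) ↔
      ∀ (F : CMField), IsGalois ℚ F → 6 ≤ Module.finrank ℚ F → ∀ f : Face F,
        ∃ ι₁ : F →+* ℂ, f.Admissible ι₁ ∧ ∃ (V : HermSpace3 F ι₁) (Γ : Level V)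
          (𝒥 : Jacobian (Var.scheme (ballQuotientUniformisedDatum_of h₁) h₃ (.pms (pmsCode F ι₁ V Γ))))
          (u₀ : 𝒥.J ⟶ (cmRealisation h₃ (cmCode F (f.psi 0))).AV)
          (u₁ : 𝒥.J ⟶ (cmRealisation h₃ (cmCode F (f.psi 1))).AV), u₀ ≠ 0 ∧ u₁ ≠ 0 :=
  faceThetaSupplyWedgeExists_iff_exists_hom_ne_zero hHD hI h₁ h₃
    (Transposition.Model.heckeWedge10_of_heckeFamily hHD hI h₁ h₃)

/-- **Item (vi) ⇔ slot reach** on a model universe, nothing else displayed: per Galois CM field `F` of degree `≥ 6` and face `f`,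
at ONE admissible `ι₁` and ONE `V`, each slot variety `A_{(F,ψ₀)}`, `A_{(F,ψ₁)}` is the target of a morphism from SOME surface of
the `V`-tower that is non-zero on `H¹(−, ℚ)` — levels independent, no eigen-class, no isotypicity.  THIS is the residual of
item (vi) in the kernel (ITEM6-SPLIT S2). [folklore] -/
theorem faceThetaSupplyWedgeExists_iff_exists_slotReach' (hHD : exists_isReal_hodgeModel)
    (hI : hodgePQ_independent_of_hodgeModel) (h₁ : BallQuotientUniformised) (h₃ : CMAbelianVarietyRealised) :
    Transposition.FaceThetaSupplyWedgeExists (picardCMUniverse hHD hI h₁ h₃) ↔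
      ∀ (F : CMField), IsGalois ℚ F → 6 ≤ Module.finrank ℚ F → ∀ f : Face F,
        ∃ ι₁ : F →+* ℂ, f.Admissible ι₁ ∧ ∃ (V : HermSpace3 F ι₁),
          (∃ (Γ : Level V) (u : (picardCMUniverse hHD hI h₁ h₃).Mor ((picardCMUniverse hHD hI h₁ h₃).pms F ι₁ V Γ)
              ((picardCMUniverse hHD hI h₁ h₃).cmAV F (f.psi 0))), (picardCMUniverse hHD hI h₁ h₃).pull u 1 ≠ 0) ∧
          (∃ (Γ : Level V) (u : (picardCMUniverse hHD hI h₁ h₃).Mor ((picardCMUniverse hHD hI h₁ h₃).pms F ι₁ V Γ)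
              ((picardCMUniverse hHD hI h₁ h₃).cmAV F (f.psi 1))), (picardCMUniverse hHD hI h₁ h₃).pull u 1 ≠ 0) :=
  faceThetaSupplyWedgeExists_iff_exists_slotReach hHD hI h₁ h₃ (Transposition.Model.heckeWedge10_of_heckeFamily hHD hI h₁ h₃)

/-- **On THE universe of record: B01-S ⇒ item (vi)**, nothing else displayed.  HC_CM is NOT proved. [folklore] -/
theorem faceThetaSupplyWedgeExists_rec_of_faceSupply'
    (hS : (picardCMUniverse exists_isReal_hodgeModel_holds hodgePQ_independent_of_hodgeModel_holds
      BallQuotient.ballQuotientUniformised_holds cmAbelianVarietyRealised_holds).FaceSupply) :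
    Transposition.FaceThetaSupplyWedgeExists (picardCMUniverse exists_isReal_hodgeModel_holds
      hodgePQ_independent_of_hodgeModel_holds BallQuotient.ballQuotientUniformised_holds cmAbelianVarietyRealised_holds) :=
  faceThetaSupplyWedgeExists_of_faceSupply' _ _ _ _ hS

/-- **`FaceThetaDataExists` from the joint ∃-statement ALONE** (supply S2 · item (iii)'s `L²` dictionary · item (v)'s isolation for
the saturated theta sets, at one `(ι₁, V)` per face) on a model universe — `Model.faceThetaDataExists_of_saturated_items` with its leaf
B01-H binder discharged.  HC_CM is NOT proved: nobody has inhabited `h`. [folklore] -/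
theorem faceThetaDataExists_of_saturated_items' (hHD : exists_isReal_hodgeModel) (hI : hodgePQ_independent_of_hodgeModel)
    (h₁ : BallQuotientUniformised) (h₃ : CMAbelianVarietyRealised)
    (h : ∀ (F : CMField), IsGalois ℚ F → 6 ≤ Module.finrank ℚ F → ∀ f : Face F,
      ∃ ι₁ : F →+* ℂ, f.Admissible ι₁ ∧ ∃ (V : HermSpace3 F ι₁),
        (∃ (Γ : Level V) (ω₀ ω₁ : (picardCMUniverse hHD hI h₁ h₃).CohC ((picardCMUniverse hHD hI h₁ h₃).pms F ι₁ V Γ) 1),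
          ω₀ ∈ (picardCMUniverse hHD hI h₁ h₃).Uiso Γ F (f.psi 0) ι₁ ∧
            ω₁ ∈ (picardCMUniverse hHD hI h₁ h₃).Uiso Γ F (f.psi 1) ι₁ ∧ ω₀ ≠ 0 ∧ ω₁ ≠ 0) ∧
        ∃ (HG : Type) (_ : NormedAddCommGroup HG) (_ : InnerProductSpace ℂ HG)
          (emb : ∀ Γ : Level V, (picardCMUniverse hHD hI h₁ h₃).CohC ((picardCMUniverse hHD hI h₁ h₃).pms F ι₁ V Γ) 2 →ₗ[ℂ] HG)
          (cover : ∀ (Γ Γ' : Level V), Γ' ≤ Γ →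
            (picardCMUniverse hHD hI h₁ h₃).Mor ((picardCMUniverse hHD hI h₁ h₃).pms F ι₁ V Γ')
              ((picardCMUniverse hHD hI h₁ h₃).pms F ι₁ V Γ)),
          (∀ (Γ : Level V) (ω₁ ω₂ : (picardCMUniverse hHD hI h₁ h₃).CohC ((picardCMUniverse hHD hI h₁ h₃).pms F ι₁ V Γ) 1),
            ω₁ ∈ (picardCMUniverse hHD hI h₁ h₃).Uiso Γ F (f.psi 0) ι₁ →
            ω₂ ∈ (picardCMUniverse hHD hI h₁ h₃).Uiso Γ F (f.psi 1) ι₁ →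
            emb Γ ((picardCMUniverse hHD hI h₁ h₃).cup2C ((picardCMUniverse hHD hI h₁ h₃).pms F ι₁ V Γ) 1 ω₁ ω₂) ∈
              (Submodule.span ℂ {x : HG | ∃ (Γ' : Level V), ∃ ω₃ ∈ (picardCMUniverse hHD hI h₁ h₃).Uiso Γ' F (f.psi 2) ι₁,
                ∃ ω₄ ∈ (picardCMUniverse hHD hI h₁ h₃).Uiso Γ' F (f.psi 3) ι₁,
                x = emb Γ' ((picardCMUniverse hHD hI h₁ h₃).cup2C ((picardCMUniverse hHD hI h₁ h₃).pms F ι₁ V Γ') 1 ω₃ ω₄)}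
                ).topologicalClosure) ∧
          (∀ (Γ Γ' : Level V) (hle : Γ' ≤ Γ)
            (x : (picardCMUniverse hHD hI h₁ h₃).CohC ((picardCMUniverse hHD hI h₁ h₃).pms F ι₁ V Γ) 2),
            emb Γ' ((picardCMUniverse hHD hI h₁ h₃).pullC (cover Γ Γ' hle) 2 x) = emb Γ x) ∧
          (∀ Γ : Level V, ∃ c : ℂ, c ≠ 0 ∧
            ∀ x y : (picardCMUniverse hHD hI h₁ h₃).CohC ((picardCMUniverse hHD hI h₁ h₃).pms F ι₁ V Γ) 2,
            x ∈ ((picardCMUniverse hHD hI h₁ h₃).hodge ((picardCMUniverse hHD hI h₁ h₃).pms F ι₁ V Γ) 2).F 2 →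
            y ∈ ((picardCMUniverse hHD hI h₁ h₃).hodge ((picardCMUniverse hHD hI h₁ h₃).pms F ι₁ V Γ) 2).F 2 →
              ⟪emb Γ y, emb Γ x⟫_ℂ = c * (picardCMUniverse hHD hI h₁ h₃).trC ((picardCMUniverse hHD hI h₁ h₃).pms F ι₁ V Γ) 4
                ((picardCMUniverse hHD hI h₁ h₃).cup2C ((picardCMUniverse hHD hI h₁ h₃).pms F ι₁ V Γ) 2 x (conj y)))) :
    (picardCMUniverse hHD hI h₁ h₃).FaceThetaDataExists :=
  faceThetaDataExists_of_saturated_items hHD hI h₁ h₃ (Transposition.Model.heckeWedge10_of_heckeFamily hHD hI h₁ h₃) h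

/-- **`FaceThetaDataExists` from the ∃ι₁ ∃V SUPPLY (S2, V-sensitive) and a ∀ι₁ ∀V DICTIONARY-WITH-ISOLATION clause (items
(iii)+(v), V-uniform)** on a model universe — the split in which the two lineages deliver: the supply chooses `(ι₁, V)`, the
dictionary and the isolation for the saturated theta sets are available at every `(ι₁, V)`.  Nothing else displayed. [folklore] -/
theorem faceThetaDataExists_of_supply_of_dictionary (hHD : exists_isReal_hodgeModel) (hI : hodgePQ_independent_of_hodgeModel)
    (h₁ : BallQuotientUniformised) (h₃ : CMAbelianVarietyRealised)
    (hS : ∀ (F : CMField), IsGalois ℚ F → 6 ≤ Module.finrank ℚ F → ∀ f : Face F,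
      ∃ ι₁ : F →+* ℂ, f.Admissible ι₁ ∧ ∃ (V : HermSpace3 F ι₁) (Γ : Level V)
        (ω₀ ω₁ : (picardCMUniverse hHD hI h₁ h₃).CohC ((picardCMUniverse hHD hI h₁ h₃).pms F ι₁ V Γ) 1),
        ω₀ ∈ (picardCMUniverse hHD hI h₁ h₃).Uiso Γ F (f.psi 0) ι₁ ∧
          ω₁ ∈ (picardCMUniverse hHD hI h₁ h₃).Uiso Γ F (f.psi 1) ι₁ ∧ ω₀ ≠ 0 ∧ ω₁ ≠ 0)
    (hD : ∀ (F : CMField), IsGalois ℚ F → 6 ≤ Module.finrank ℚ F → ∀ (f : Face F) (ι₁ : F →+* ℂ), f.Admissible ι₁ →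
      ∀ V : HermSpace3 F ι₁,
        ∃ (HG : Type) (_ : NormedAddCommGroup HG) (_ : InnerProductSpace ℂ HG)
          (emb : ∀ Γ : Level V, (picardCMUniverse hHD hI h₁ h₃).CohC ((picardCMUniverse hHD hI h₁ h₃).pms F ι₁ V Γ) 2 →ₗ[ℂ] HG)
          (cover : ∀ (Γ Γ' : Level V), Γ' ≤ Γ →
            (picardCMUniverse hHD hI h₁ h₃).Mor ((picardCMUniverse hHD hI h₁ h₃).pms F ι₁ V Γ')
              ((picardCMUniverse hHD hI h₁ h₃).pms F ι₁ V Γ)),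
          (∀ (Γ : Level V) (ω₁ ω₂ : (picardCMUniverse hHD hI h₁ h₃).CohC ((picardCMUniverse hHD hI h₁ h₃).pms F ι₁ V Γ) 1),
            ω₁ ∈ (picardCMUniverse hHD hI h₁ h₃).Uiso Γ F (f.psi 0) ι₁ →
            ω₂ ∈ (picardCMUniverse hHD hI h₁ h₃).Uiso Γ F (f.psi 1) ι₁ →
            emb Γ ((picardCMUniverse hHD hI h₁ h₃).cup2C ((picardCMUniverse hHD hI h₁ h₃).pms F ι₁ V Γ) 1 ω₁ ω₂) ∈
              (Submodule.span ℂ {x : HG | ∃ (Γ' : Level V), ∃ ω₃ ∈ (picardCMUniverse hHD hI h₁ h₃).Uiso Γ' F (f.psi 2) ι₁,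
                ∃ ω₄ ∈ (picardCMUniverse hHD hI h₁ h₃).Uiso Γ' F (f.psi 3) ι₁,
                x = emb Γ' ((picardCMUniverse hHD hI h₁ h₃).cup2C ((picardCMUniverse hHD hI h₁ h₃).pms F ι₁ V Γ') 1 ω₃ ω₄)}
                ).topologicalClosure) ∧
          (∀ (Γ Γ' : Level V) (hle : Γ' ≤ Γ)
            (x : (picardCMUniverse hHD hI h₁ h₃).CohC ((picardCMUniverse hHD hI h₁ h₃).pms F ι₁ V Γ) 2),
            emb Γ' ((picardCMUniverse hHD hI h₁ h₃).pullC (cover Γ Γ' hle) 2 x) = emb Γ x) ∧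
          (∀ Γ : Level V, ∃ c : ℂ, c ≠ 0 ∧
            ∀ x y : (picardCMUniverse hHD hI h₁ h₃).CohC ((picardCMUniverse hHD hI h₁ h₃).pms F ι₁ V Γ) 2,
            x ∈ ((picardCMUniverse hHD hI h₁ h₃).hodge ((picardCMUniverse hHD hI h₁ h₃).pms F ι₁ V Γ) 2).F 2 →
            y ∈ ((picardCMUniverse hHD hI h₁ h₃).hodge ((picardCMUniverse hHD hI h₁ h₃).pms F ι₁ V Γ) 2).F 2 →
              ⟪emb Γ y, emb Γ x⟫_ℂ = c * (picardCMUniverse hHD hI h₁ h₃).trC ((picardCMUniverse hHD hI h₁ h₃).pms F ι₁ V Γ) 4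
                ((picardCMUniverse hHD hI h₁ h₃).cup2C ((picardCMUniverse hHD hI h₁ h₃).pms F ι₁ V Γ) 2 x (conj y)))) :
    (picardCMUniverse hHD hI h₁ h₃).FaceThetaDataExists := by
  refine faceThetaDataExists_of_saturated_items' hHD hI h₁ h₃ fun F hG h6 f => ?_
  obtain ⟨ι₁, hι, V, Γ, ω₀, ω₁, h₀, h₁', hne₀, hne₁⟩ := hS F hG h6 f
  obtain ⟨HG, _, _, emb, cover, hiso, hcov, hinner⟩ := hD F hG h6 f ι₁ hι V
  exact ⟨ι₁, hι, V, ⟨Γ, ω₀, ω₁, h₀, h₁', hne₀, hne₁⟩, HG, _, _, emb, cover, hiso, hcov, hinner⟩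

/-- **END-DISPLAY SHAPE on THE universe of record: `HC_CM` from the ∃ι₁ ∃V SUPPLY (S2) and the ∀ι₁ ∀V DICTIONARY-WITH-ISOLATION
clause (items (iii)+(v)) — and NOTHING else** (`Model.hc_cm_closed_of_faceThetaDataExists`, `Transposition/Assembly.lean:85`, over
`faceThetaDataExists_of_supply_of_dictionary`; B01-H, the facts, Hodge–Riemann (2,0), Landherr, admissibility are all tree
theorems).  Stated for a universe `U` together with the equation `hU : U = U_rec` (instantiate with `rfl`), so that the two
displayed statements are legible.  The AS-PRINTED rewire of ruling 13:05:07Z is to be read against THIS shape: `hS` is where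
[Liu 2021 Thm 4.18] (with its construction binders) lands, `hD` is where item (iii)'s Matsushima/Petersson dictionary and item
(v)'s Thm 3.7 land.  HC_CM is NOT proved: neither `hS` nor `hD` is inhabited. [folklore] -/
theorem hc_cm_of_supply_of_dictionary_of_eq (U : Universe)
    (hU : U = picardCMUniverse exists_isReal_hodgeModel_holds hodgePQ_independent_of_hodgeModel_holds
      BallQuotient.ballQuotientUniformised_holds cmAbelianVarietyRealised_holds)
    (hS : ∀ (F : CMField), IsGalois ℚ F → 6 ≤ Module.finrank ℚ F → ∀ f : Face F,
      ∃ ι₁ : F →+* ℂ, f.Admissible ι₁ ∧ ∃ (V : HermSpace3 F ι₁) (Γ : Level V) (ω₀ ω₁ : U.CohC (U.pms F ι₁ V Γ) 1),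
        ω₀ ∈ U.Uiso Γ F (f.psi 0) ι₁ ∧ ω₁ ∈ U.Uiso Γ F (f.psi 1) ι₁ ∧ ω₀ ≠ 0 ∧ ω₁ ≠ 0)
    (hD : ∀ (F : CMField), IsGalois ℚ F → 6 ≤ Module.finrank ℚ F → ∀ (f : Face F) (ι₁ : F →+* ℂ), f.Admissible ι₁ →
      ∀ V : HermSpace3 F ι₁,
        ∃ (HG : Type) (_ : NormedAddCommGroup HG) (_ : InnerProductSpace ℂ HG)
          (emb : ∀ Γ : Level V, U.CohC (U.pms F ι₁ V Γ) 2 →ₗ[ℂ] HG)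
          (cover : ∀ (Γ Γ' : Level V), Γ' ≤ Γ → U.Mor (U.pms F ι₁ V Γ') (U.pms F ι₁ V Γ)),
          (∀ (Γ : Level V) (ω₁ ω₂ : U.CohC (U.pms F ι₁ V Γ) 1), ω₁ ∈ U.Uiso Γ F (f.psi 0) ι₁ → ω₂ ∈ U.Uiso Γ F (f.psi 1) ι₁ →
            emb Γ (U.cup2C (U.pms F ι₁ V Γ) 1 ω₁ ω₂) ∈ (Submodule.span ℂ
              {x : HG | ∃ (Γ' : Level V), ∃ ω₃ ∈ U.Uiso Γ' F (f.psi 2) ι₁, ∃ ω₄ ∈ U.Uiso Γ' F (f.psi 3) ι₁,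
                x = emb Γ' (U.cup2C (U.pms F ι₁ V Γ') 1 ω₃ ω₄)}).topologicalClosure) ∧
          (∀ (Γ Γ' : Level V) (hle : Γ' ≤ Γ) (x : U.CohC (U.pms F ι₁ V Γ) 2),
            emb Γ' (U.pullC (cover Γ Γ' hle) 2 x) = emb Γ x) ∧
          (∀ Γ : Level V, ∃ c : ℂ, c ≠ 0 ∧ ∀ x y : U.CohC (U.pms F ι₁ V Γ) 2,
            x ∈ (U.hodge (U.pms F ι₁ V Γ) 2).F 2 → y ∈ (U.hodge (U.pms F ι₁ V Γ) 2).F 2 →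
              ⟪emb Γ y, emb Γ x⟫_ℂ = c * U.trC (U.pms F ι₁ V Γ) 4 (U.cup2C (U.pms F ι₁ V Γ) 2 x (conj y)))) :
    HC_CM := by
  subst hU
  exact hc_cm_closed_of_faceThetaDataExists (faceThetaDataExists_of_supply_of_dictionary _ _ _ _ hS hD)

end Model


/-! ## The pinned datum: ONE coupled non-zero (12)-wedge per face suffices (no B01-H, no separate supply, no ∀-coupling) -/

namespace Transposition

open Literature.AlgebraicGeometry.Motives (CMType HodgeStructure)
open Literature.AlgebraicGeometry.Motives.HodgeStructure (conj)

/-- **`FaceThetaDataExists` from the `L²` dictionary and ONE COUPLED NON-ZERO (12)-WEDGE per face** — the sharpest joint form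
of items (v)+(vi) on this path.  Per Galois CM field `F` of degree `≥ 6` and face `f`, at one admissible `(ι₁, V)`: item (iii)'s
`(HG, emb, cover, emb_cover, inner_emb)` and ONE level `Γ` with classes `ω₀ ∈ U_{ψ₀}(Γ)`, `ω₁ ∈ U_{ψ₁}(Γ)` such that
`ω₀ ∪ ω₁ ≠ 0` AND `emb Γ (ω₀ ∪ ω₁)` lies in the closed span of the (34)-wedge-functions of `U_{ψ₂}`, `U_{ψ₃}`-classes over all
levels.  Proof: the PINNED theta sets `Θ₀ = {ω₀}` and `Θ₁ = {ω₁}` at the level `Γ` (empty elsewhere), `Θ₂ = U_{ψ₂}`, `Θ₃ = U_{ψ₃}`: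
`Theta_sub` is membership, `coupling` is the one hypothesis, `lineField` is `emb Γ (ω₀ ∪ ω₁) ≠ 0` by Hodge–Riemann (2,0) +
`inner_emb` (`emb_ne_zero_of_hodgeRiemann`, `Universe.cup2C_mem_F_two_of_Uiso`).  So neither the leaf B01-H nor a separate supply
nor item (v)'s coupling for ALL classes is needed by the engine: supply + B01-H merely PRODUCE non-zero (12)-wedges (many — every
pair of Hecke translates), and coupling is needed for ONE of them.  Binders: `Fact_pull_hodge`, `Fact_cup2_hodge`, HR (2,0), `h`. [folklore] -/
theorem faceThetaDataExists_of_wedgeMeet {U : Universe} (hH : U.Fact_pull_hodge) (hcup2 : U.Fact_cup2_hodge)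
    (hHR : ∀ {L : CMField} {ι₁ : L →+* ℂ} {V : HermSpace3 L ι₁} (Γ : Level V) (η : U.CohC (U.pms L ι₁ V Γ) 2),
      η ∈ (U.hodge (U.pms L ι₁ V Γ) 2).F 2 → η ≠ 0 → U.trC (U.pms L ι₁ V Γ) 4 (U.cup2C (U.pms L ι₁ V Γ) 2 η (conj η)) ≠ 0)
    (h : ∀ (F : CMField), IsGalois ℚ F → 6 ≤ Module.finrank ℚ F → ∀ f : Face F,
      ∃ ι₁ : F →+* ℂ, f.Admissible ι₁ ∧ ∃ (V : HermSpace3 F ι₁)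
        (HG : Type) (_ : NormedAddCommGroup HG) (_ : InnerProductSpace ℂ HG)
        (emb : ∀ Γ : Level V, U.CohC (U.pms F ι₁ V Γ) 2 →ₗ[ℂ] HG)
        (cover : ∀ (Γ Γ' : Level V), Γ' ≤ Γ → U.Mor (U.pms F ι₁ V Γ') (U.pms F ι₁ V Γ)),
        (∀ (Γ Γ' : Level V) (hle : Γ' ≤ Γ) (x : U.CohC (U.pms F ι₁ V Γ) 2),
          emb Γ' (U.pullC (cover Γ Γ' hle) 2 x) = emb Γ x) ∧
        (∀ Γ : Level V, ∃ c : ℂ, c ≠ 0 ∧ ∀ x y : U.CohC (U.pms F ι₁ V Γ) 2,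
          x ∈ (U.hodge (U.pms F ι₁ V Γ) 2).F 2 → y ∈ (U.hodge (U.pms F ι₁ V Γ) 2).F 2 →
            ⟪emb Γ y, emb Γ x⟫_ℂ = c * U.trC (U.pms F ι₁ V Γ) 4 (U.cup2C (U.pms F ι₁ V Γ) 2 x (conj y))) ∧
        ∃ (Γ : Level V) (ω₀ ω₁ : U.CohC (U.pms F ι₁ V Γ) 1),
          ω₀ ∈ U.Uiso Γ F (f.psi 0) ι₁ ∧ ω₁ ∈ U.Uiso Γ F (f.psi 1) ι₁ ∧ U.cup2C (U.pms F ι₁ V Γ) 1 ω₀ ω₁ ≠ 0 ∧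
          emb Γ (U.cup2C (U.pms F ι₁ V Γ) 1 ω₀ ω₁) ∈ (Submodule.span ℂ
            {x : HG | ∃ (Γ' : Level V), ∃ ω₃ ∈ U.Uiso Γ' F (f.psi 2) ι₁, ∃ ω₄ ∈ U.Uiso Γ' F (f.psi 3) ι₁,
              x = emb Γ' (U.cup2C (U.pms F ι₁ V Γ') 1 ω₃ ω₄)}).topologicalClosure) :
    U.FaceThetaDataExists := by
  intro F hG h6 f
  obtain ⟨ι₁, hι, V, HG, _, _, emb, cover, hcov, hinner, Γ, ω₀, ω₁, h₀, h₁, hcup, hmeet⟩ := h F hG h6 f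
  -- the pinned theta sets: slots 0, 1 = the two witnesses at the level `Γ` only; slots 2, 3 = the isotypic spaces
  let Θ : Fin 4 → ∀ Γ' : Level V, Set (U.CohC (U.pms F ι₁ V Γ') 1) := fun i Γ' =>
    {η | (i = 0 → ∃ _ : Γ' = Γ, HEq η ω₀) ∧ (i = 1 → ∃ _ : Γ' = Γ, HEq η ω₁) ∧
      (i = 2 → η ∈ U.Uiso Γ' F (f.psi 2) ι₁) ∧ (i = 3 → η ∈ U.Uiso Γ' F (f.psi 3) ι₁)}
  have m₀ : ω₀ ∈ Θ 0 Γ :=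
    ⟨fun _ => ⟨rfl, HEq.rfl⟩, fun h => absurd h (by decide), fun h => absurd h (by decide), fun h => absurd h (by decide)⟩
  have m₁ : ω₁ ∈ Θ 1 Γ :=
    ⟨fun h => absurd h (by decide), fun _ => ⟨rfl, HEq.rfl⟩, fun h => absurd h (by decide), fun h => absurd h (by decide)⟩
  have hne : emb Γ (U.cup2C (U.pms F ι₁ V Γ) 1 ω₀ ω₁) ≠ 0 :=
    emb_ne_zero_of_hodgeRiemann (emb Γ) (hinner Γ) (hHR Γ)
      (Universe.cup2C_mem_F_two_of_Uiso hH hcup2 Γ F (f.psi 0) (f.psi 1) ι₁ h₀ h₁) hcup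
  -- `Theta_sub`: the witnesses are isotypic classes; slots 2, 3 are the isotypic spaces
  have hsub : ∀ (i : Fin 4) (Γ' : Level V), Θ i Γ' ⊆ U.Uiso Γ' F (f.psi i) ι₁ := by
    intro i Γ' η hη
    obtain ⟨hη0, hη1, hη2, hη3⟩ := hη
    match i with
    | 0 => obtain ⟨e, hη⟩ := hη0 rfl; subst e; rw [eq_of_heq hη]; exact h₀
    | 1 => obtain ⟨e, hη⟩ := hη1 rfl; subst e; rw [eq_of_heq hη]; exact h₁
    | 2 => exact hη2 rfl
    | 3 => exact hη3 rfl
  -- `coupling`: the only (12)-pair is `(ω₀, ω₁)` at the level `Γ`, and it is coupled by hypothesis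
  have hcoup : ∀ (Γ' : Level V) (η η' : U.CohC (U.pms F ι₁ V Γ') 1), η ∈ Θ 0 Γ' → η' ∈ Θ 1 Γ' →
      emb Γ' (U.cup2C (U.pms F ι₁ V Γ') 1 η η') ∈ (Submodule.span ℂ
        {x : HG | ∃ (Γ'' : Level V), ∃ ω₃ ∈ Θ 2 Γ'', ∃ ω₄ ∈ Θ 3 Γ'',
          x = emb Γ'' (U.cup2C (U.pms F ι₁ V Γ'') 1 ω₃ ω₄)}).topologicalClosure := by
    intro Γ' η η' hη hη'
    obtain ⟨e, hη⟩ := hη.1 rfl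
    subst e
    obtain ⟨_, hη'⟩ := hη'.2.1 rfl
    rw [eq_of_heq hη, eq_of_heq hη']
    refine Submodule.topologicalClosure_mono (Submodule.span_mono ?_) hmeet
    rintro x ⟨Γ'', ω₃, h₃, ω₄, h₄, rfl⟩
    exact ⟨Γ'', ω₃, ⟨fun h => absurd h (by decide), fun h => absurd h (by decide), fun _ => h₃, fun h => absurd h (by decide)⟩,
      ω₄, ⟨fun h => absurd h (by decide), fun h => absurd h (by decide), fun h => absurd h (by decide), fun _ => h₄⟩, rfl⟩
  exact ⟨ι₁, hι, V, ⟨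
    { HG := HG
      emb := emb
      Theta := Θ
      Theta_sub := hsub
      lineField := ⟨Γ, ω₀, m₀, ω₁, m₁, hne⟩
      coupling := hcoup
      cover := cover
      emb_cover := hcov
      inner_emb := hinner }⟩⟩

/-- **The pinned form is a NORMAL FORM of the socket**: over any universe with `Fact_pull_hodge`, `Fact_cup2_hodge` and
Hodge–Riemann (2,0) on the towers, `U.FaceThetaDataExists` (`Transposition/Assembly.lean:52`) is EQUIVALENT to «per face, at one
admissible `(ι₁, V)`: the `L²` dictionary and ONE non-zero (12)-wedge of isotypic classes whose `L²`-image lies in the closed span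
of the (34)-wedge-functions of isotypic classes».  (→: a datum's `lineField` pair is such a wedge — its factors are isotypic by
`Theta_sub`, it is non-zero because its image is, and it is coupled into the (34)-span of the datum's theta sets, which lies in
that of the isotypic spaces; ←: `faceThetaDataExists_of_wedgeMeet`.)  So the theta-set DATA of the socket carry exactly this one
existential and nothing more. [folklore] -/
theorem faceThetaDataExists_iff_wedgeMeet {U : Universe} (hH : U.Fact_pull_hodge) (hcup2 : U.Fact_cup2_hodge)
    (hHR : ∀ {L : CMField} {ι₁ : L →+* ℂ} {V : HermSpace3 L ι₁} (Γ : Level V) (η : U.CohC (U.pms L ι₁ V Γ) 2),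
      η ∈ (U.hodge (U.pms L ι₁ V Γ) 2).F 2 → η ≠ 0 → U.trC (U.pms L ι₁ V Γ) 4 (U.cup2C (U.pms L ι₁ V Γ) 2 η (conj η)) ≠ 0) :
    U.FaceThetaDataExists ↔
      ∀ (F : CMField), IsGalois ℚ F → 6 ≤ Module.finrank ℚ F → ∀ f : Face F,
        ∃ ι₁ : F →+* ℂ, f.Admissible ι₁ ∧ ∃ (V : HermSpace3 F ι₁)
          (HG : Type) (_ : NormedAddCommGroup HG) (_ : InnerProductSpace ℂ HG)
          (emb : ∀ Γ : Level V, U.CohC (U.pms F ι₁ V Γ) 2 →ₗ[ℂ] HG)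
          (cover : ∀ (Γ Γ' : Level V), Γ' ≤ Γ → U.Mor (U.pms F ι₁ V Γ') (U.pms F ι₁ V Γ)),
          (∀ (Γ Γ' : Level V) (hle : Γ' ≤ Γ) (x : U.CohC (U.pms F ι₁ V Γ) 2),
            emb Γ' (U.pullC (cover Γ Γ' hle) 2 x) = emb Γ x) ∧
          (∀ Γ : Level V, ∃ c : ℂ, c ≠ 0 ∧ ∀ x y : U.CohC (U.pms F ι₁ V Γ) 2,
            x ∈ (U.hodge (U.pms F ι₁ V Γ) 2).F 2 → y ∈ (U.hodge (U.pms F ι₁ V Γ) 2).F 2 →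
              ⟪emb Γ y, emb Γ x⟫_ℂ = c * U.trC (U.pms F ι₁ V Γ) 4 (U.cup2C (U.pms F ι₁ V Γ) 2 x (conj y))) ∧
          ∃ (Γ : Level V) (ω₀ ω₁ : U.CohC (U.pms F ι₁ V Γ) 1),
            ω₀ ∈ U.Uiso Γ F (f.psi 0) ι₁ ∧ ω₁ ∈ U.Uiso Γ F (f.psi 1) ι₁ ∧ U.cup2C (U.pms F ι₁ V Γ) 1 ω₀ ω₁ ≠ 0 ∧
            emb Γ (U.cup2C (U.pms F ι₁ V Γ) 1 ω₀ ω₁) ∈ (Submodule.span ℂ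
              {x : HG | ∃ (Γ' : Level V), ∃ ω₃ ∈ U.Uiso Γ' F (f.psi 2) ι₁, ∃ ω₄ ∈ U.Uiso Γ' F (f.psi 3) ι₁,
                x = emb Γ' (U.cup2C (U.pms F ι₁ V Γ') 1 ω₃ ω₄)}).topologicalClosure := by
  refine ⟨fun hR F hG h6 f => ?_, faceThetaDataExists_of_wedgeMeet hH hcup2 hHR⟩
  obtain ⟨ι₁, hι, V, ⟨R⟩⟩ := hR F hG h6 f
  obtain ⟨Γ, ω₀, hω₀, ω₁, hω₁, hne⟩ := R.lineField
  refine ⟨ι₁, hι, V, R.HG, inferInstance, inferInstance, R.emb, R.cover, R.emb_cover, R.inner_emb, Γ, ω₀, ω₁,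
    R.Theta_sub 0 Γ hω₀, R.Theta_sub 1 Γ hω₁, fun h0 => hne (by rw [h0, map_zero]), ?_⟩
  refine Submodule.topologicalClosure_mono (Submodule.span_mono ?_) (R.coupling Γ ω₀ ω₁ hω₀ hω₁)
  rintro x ⟨Γ', ω₃, h₃, ω₄, h₄, rfl⟩
  exact ⟨Γ', ω₃, R.Theta_sub 2 Γ' h₃, ω₄, R.Theta_sub 3 Γ' h₄, rfl⟩

end Transposition

namespace Model

open Literature.AlgebraicGeometry.Motives (CMType HodgeStructure)
open Literature.AlgebraicGeometry.Motives.HodgeStructure (conj)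
open Literature.NumberTheory.Automorphic
open Literature.NumberTheory.Automorphic.PicardCM
open Literature.AlgebraicGeometry.HodgeTheory

/-- **END-DISPLAY SHAPE, pinned form, on THE universe of record (`hU : U = U_rec`, by `rfl`): `HC_CM` from ONE statement** — per
Galois CM field `F` of degree `≥ 6` and face `f`, at one admissible `(ι₁, V)`: item (iii)'s `L²` dictionary and ONE non-zero
(12)-wedge of `U_{ψ₀}`/`U_{ψ₁}`-classes whose `L²`-image lies in the closed span of the (34)-wedge-functions of
`U_{ψ₂}`/`U_{ψ₃}`-classes (`Transposition.faceThetaDataExists_of_wedgeMeet` + `Model.hc_cm_closed_of_faceThetaDataExists`; the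
facts and Hodge–Riemann (2,0) are the tree theorems `universeOf_fact_pull_hodge`, `universeOf_fact_cup2_hodge`,
`universeOf_hodgeRiemann_pms`).  The existence of non-zero (12)-wedges is what SUPPLY + B01-H give
(`Transposition.exists_lineField_witness` ∘ `faceThetaSupplyWedgeExists_iff_exists_supply'`); that ONE of them is coupled is the
existential core of item (v).  HC_CM is NOT proved: nobody has inhabited `h`. [folklore] -/
theorem hc_cm_of_wedgeMeet_of_eq (U : Universe)
    (hU : U = picardCMUniverse exists_isReal_hodgeModel_holds hodgePQ_independent_of_hodgeModel_holds
      BallQuotient.ballQuotientUniformised_holds cmAbelianVarietyRealised_holds)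
    (h : ∀ (F : CMField), IsGalois ℚ F → 6 ≤ Module.finrank ℚ F → ∀ f : Face F,
      ∃ ι₁ : F →+* ℂ, f.Admissible ι₁ ∧ ∃ (V : HermSpace3 F ι₁)
        (HG : Type) (_ : NormedAddCommGroup HG) (_ : InnerProductSpace ℂ HG)
        (emb : ∀ Γ : Level V, U.CohC (U.pms F ι₁ V Γ) 2 →ₗ[ℂ] HG)
        (cover : ∀ (Γ Γ' : Level V), Γ' ≤ Γ → U.Mor (U.pms F ι₁ V Γ') (U.pms F ι₁ V Γ)),
        (∀ (Γ Γ' : Level V) (hle : Γ' ≤ Γ) (x : U.CohC (U.pms F ι₁ V Γ) 2),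
          emb Γ' (U.pullC (cover Γ Γ' hle) 2 x) = emb Γ x) ∧
        (∀ Γ : Level V, ∃ c : ℂ, c ≠ 0 ∧ ∀ x y : U.CohC (U.pms F ι₁ V Γ) 2,
          x ∈ (U.hodge (U.pms F ι₁ V Γ) 2).F 2 → y ∈ (U.hodge (U.pms F ι₁ V Γ) 2).F 2 →
            ⟪emb Γ y, emb Γ x⟫_ℂ = c * U.trC (U.pms F ι₁ V Γ) 4 (U.cup2C (U.pms F ι₁ V Γ) 2 x (conj y))) ∧
        ∃ (Γ : Level V) (ω₀ ω₁ : U.CohC (U.pms F ι₁ V Γ) 1),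
          ω₀ ∈ U.Uiso Γ F (f.psi 0) ι₁ ∧ ω₁ ∈ U.Uiso Γ F (f.psi 1) ι₁ ∧ U.cup2C (U.pms F ι₁ V Γ) 1 ω₀ ω₁ ≠ 0 ∧
          emb Γ (U.cup2C (U.pms F ι₁ V Γ) 1 ω₀ ω₁) ∈ (Submodule.span ℂ
            {x : HG | ∃ (Γ' : Level V), ∃ ω₃ ∈ U.Uiso Γ' F (f.psi 2) ι₁, ∃ ω₄ ∈ U.Uiso Γ' F (f.psi 3) ι₁,
              x = emb Γ' (U.cup2C (U.pms F ι₁ V Γ') 1 ω₃ ω₄)}).topologicalClosure) :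
    HC_CM := by
  subst hU
  exact hc_cm_closed_of_faceThetaDataExists
    (Transposition.faceThetaDataExists_of_wedgeMeet (universeOf_fact_pull_hodge _ _ _ _) (universeOf_fact_cup2_hodge _ _ _ _)
      (fun Γ η hη h0 => universeOf_hodgeRiemann_pms _ _ _ _ _ Γ η hη h0) h)

end Model

end Summit.HodgeConjecture.CorCM

end
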